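import Summits.ValiantsHypothesis.ValiantsHypothesis.Theorems.DivisionGapSquareGridDimersDivisionEasy
import Summits.ValiantsHypothesis.ValiantsHypothesis.Theorems.DivisionGapZeroOneTransferProjClosure
import Summits.ValiantsHypothesis.ValiantsHypothesis.Theorems.DivisionGapZeroOneTransferStubFormulaGridProjection
import Literature.Computability.AlgebraicComplexity.ArithCircuitProofs
import Literature.Computability.AlgebraicComplexity.QuasiPolynomialFormulasProofs

/-!
# Crux `ZeroOneTransfer` (stmt-ValiantsHypothesis-5066), line `planar-dimer-sign-elimination` —
the reduction `SignElimination → ZeroOneTransfer` (the line's composition, every other stub landed)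

`signEliminationReduction`: the bet (S) of line `planar-dimer-sign-elimination` — "a 0/1-coefficient
family over `ℝ≥0` whose complexification is a quasi-polynomial Valiant projection over `ℂ` of the
square-grid dimer polynomial `PM_ℂ(N)` is a ratio `f_n · Σ_i m_i = Σ_j g_j` of two short sums of
MONOTONE grid-dimer projections" (stated inline as the hypothesis `hS`, verbatim the registered stub
`stub_signElimination`) — implies the crux `DivisionGap.ZeroOneTransfer`.  This is the line's
composition `ZeroOneTransfer_of` with its three other stubs replaced by the tree theorems that now
prove them: (U) `stub_formulaGridProjection` (formulas are projections of grid dimers over every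
commutative semiring, Theorems/DivisionGapZeroOneTransferStubFormulaGridProjection.lean), (G)
`squareGridDimersDivisionEasy_proof` (item 5072, urban renewal) and (F1) `stub_projClosure`
(projection closure of division certificates with zero constants).  Glue: `VP ⊆ VQP`
(`IsVPFamily.isVQPFamily`) and `VQP_e = VQP` (`BCS1997_thm_21_33_holds`) bound the formula size of the
complexification quasi-polynomially, (U) at `R = ℂ` gives the hypothesis of (S); (S) returns
`f_n · M = G`; (G) gives one cofactor for `PM_{ℝ≥0}(N)`, (F1) transports it to every summand, and the
bookkeeping `sum_prod_bound` / `quotient_bound` / `arith` / `absorb₁` / `absorb₂` (the planner's glue of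
the skeleton `Cruxes/ZeroOneTransfer/Lines/planar_dimer_sign_elimination.lean`, reproduced) assembles
the cofactor `H = (Σ m_i) · Π hm_i · Π hg_j` of `f_n` under one quasi-polynomial bound.

Companion of `stub_spanReduction` (line `arborescence-span`) and `forestQuotientReduction` (line
`hidden-markov-intertwiner`): with it, each of the three r1 lines of the crux is reduced to its single
bet.  Unconditional; axioms `propext`, `Classical.choice`, `Quot.sound`.
-/

open MvPolynomial Finset
open scoped BigOperators
open Literature.Computability.AlgebraicComplexity
open Summit.ValiantsHypothesis.ValiantsHypothesis.Theses.DivisionGap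

-- `Summit.ValiantsHypothesis.ValiantsHypothesis.…`: mandated layout (Sub = Summit), intended.
set_option linter.dupNamespace false

namespace Summit.ValiantsHypothesis.ValiantsHypothesis.Theorems.DivisionGapZeroOneTransfer

namespace SignEliminationReduction

/-! ## Bookkeeping (the skeleton's glue) -/

/-- Bookkeeping: if every `u_i` has cofactor `h_i` within budget `s`, then
`(Σ_i u_i) · Π_i h_i = Σ_i (u_i h_i) · Π_{k ≠ i} h_k` costs `≤ I (s + (I s + I) + 1) + I` and every sub-product
`Π_{i ∈ S} h_i` costs `≤ I s + I` (`complexity_finset_sum_le`, `complexity_finset_prod_le`, `complexity_mul_le`).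
[folklore] -/
theorem sum_prod_bound {τ : Type*} {I : ℕ} (u hu : Fin I → MvPolynomial τ NNReal) (s : ℕ)
    (hle : ∀ i, complexity (u i * hu i) + complexity (hu i) ≤ s) :
    complexity ((∑ i, u i) * ∏ i, hu i) ≤ I * (s + (I * s + I) + 1) + I ∧
      ∀ S : Finset (Fin I), complexity (∏ i ∈ S, hu i) ≤ I * s + I := by
  classical
  have hL_hu : ∀ i, complexity (hu i) ≤ s := fun i => (Nat.le_add_left _ _).trans (hle i)
  have hL_uhu : ∀ i, complexity (u i * hu i) ≤ s := fun i => (Nat.le_add_right _ _).trans (hle i)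
  have hprod : ∀ S : Finset (Fin I), complexity (∏ i ∈ S, hu i) ≤ I * s + I := by
    intro S
    have hS : S.card ≤ I := (Finset.card_le_univ S).trans (by rw [Fintype.card_fin])
    calc complexity (∏ i ∈ S, hu i) ≤ ∑ i ∈ S, complexity (hu i) + S.card :=
          complexity_finset_prod_le S hu
      _ ≤ ∑ i ∈ S, s + S.card := by gcongr with i _; exact hL_hu i
      _ = S.card * s + S.card := by rw [Finset.sum_const, smul_eq_mul]
      _ ≤ I * s + I := by gcongr
  refine ⟨?_, hprod⟩
  have hrw : (∑ i, u i) * ∏ i, hu i = ∑ i, (u i * hu i) * ∏ k ∈ Finset.univ.erase i, hu k := by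
    rw [Finset.sum_mul]
    refine Finset.sum_congr rfl fun i _ => ?_
    rw [← Finset.mul_prod_erase Finset.univ hu (Finset.mem_univ i)]
    ring
  rw [hrw]
  calc complexity (∑ i, (u i * hu i) * ∏ k ∈ Finset.univ.erase i, hu k)
      ≤ ∑ i, complexity ((u i * hu i) * ∏ k ∈ Finset.univ.erase i, hu k) +
          (Finset.univ : Finset (Fin I)).card := complexity_finset_sum_le _ _
    _ ≤ ∑ _i : Fin I, (s + (I * s + I) + 1) + (Finset.univ : Finset (Fin I)).card := by
        gcongr with i _
        have h1 := hL_uhu i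
        have h2 := hprod (Finset.univ.erase i)
        calc complexity ((u i * hu i) * ∏ k ∈ Finset.univ.erase i, hu k)
            ≤ complexity (u i * hu i) + complexity (∏ k ∈ Finset.univ.erase i, hu k) + 1 :=
              complexity_mul_le_holds _ _
          _ ≤ s + (I * s + I) + 1 := by gcongr
    _ = I * (s + (I * s + I) + 1) + I := by
        rw [Finset.sum_const, smul_eq_mul, Finset.card_univ, Fintype.card_fin]

/-- Bookkeeping for a ratio of two short sums: from `f · Σ_i m_i = Σ_j g_j` and cofactors `hm_i`, `hg_j` within
budget `s`, the cofactor `H := (Σ_i m_i) · Π_i hm_i · Π_j hg_j` of `f` satisfies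
`f · H = ((Σ_j g_j) · Π_j hg_j) · Π_i hm_i` and an explicit polynomial bound in `I, J, s`. [folklore] -/
theorem quotient_bound {τ : Type*} {I J : ℕ} (f : MvPolynomial τ NNReal)
    (m hm : Fin I → MvPolynomial τ NNReal) (g hg : Fin J → MvPolynomial τ NNReal) (s : ℕ)
    (hfm : f * ∑ i, m i = ∑ j, g j)
    (hmle : ∀ i, complexity (m i * hm i) + complexity (hm i) ≤ s)
    (hgle : ∀ j, complexity (g j * hg j) + complexity (hg j) ≤ s) :
    complexity (f * ((∑ i, m i) * (∏ i, hm i) * ∏ j, hg j)) +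
        complexity ((∑ i, m i) * (∏ i, hm i) * ∏ j, hg j) ≤
      (J * (s + (J * s + J) + 1) + J + (I * s + I) + 1) +
        (I * (s + (I * s + I) + 1) + I + (J * s + J) + 1) := by
  obtain ⟨hM, hPm⟩ := sum_prod_bound m hm s hmle
  obtain ⟨hG, hPg⟩ := sum_prod_bound g hg s hgle
  have hrw : f * ((∑ i, m i) * (∏ i, hm i) * ∏ j, hg j) = ((∑ j, g j) * ∏ j, hg j) * ∏ i, hm i := by
    rw [← hfm]; ring
  refine add_le_add ?_ ?_
  · rw [hrw]
    have h1 := hPm Finset.univ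
    calc complexity (((∑ j, g j) * ∏ j, hg j) * ∏ i, hm i)
        ≤ complexity ((∑ j, g j) * ∏ j, hg j) + complexity (∏ i, hm i) + 1 := complexity_mul_le_holds _ _
      _ ≤ J * (s + (J * s + J) + 1) + J + (I * s + I) + 1 := by gcongr
  · have h1 := hPg Finset.univ
    calc complexity ((∑ i, m i) * (∏ i, hm i) * ∏ j, hg j)
        ≤ complexity ((∑ i, m i) * ∏ i, hm i) + complexity (∏ j, hg j) + 1 := complexity_mul_le_holds _ _
      _ ≤ I * (s + (I * s + I) + 1) + I + (J * s + J) + 1 := by gcongr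

/-- Arithmetic: with `N, I, J ≤ Q := 2^((ℓ + c)^c)` and budget `s = N^d + d`, the bound of `quotient_bound` is
at most `16 (d+1) Q^(d+2)`. [folklore] -/
theorem arith {N I J d c ℓ : ℕ} (hN : N ≤ 2 ^ ((ℓ + c) ^ c)) (hI : I ≤ 2 ^ ((ℓ + c) ^ c))
    (hJ : J ≤ 2 ^ ((ℓ + c) ^ c)) :
    (J * ((N ^ d + d) + (J * (N ^ d + d) + J) + 1) + J + (I * (N ^ d + d) + I) + 1) +
        (I * ((N ^ d + d) + (I * (N ^ d + d) + I) + 1) + I + (J * (N ^ d + d) + J) + 1) ≤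
      16 * (d + 1) * (2 ^ ((ℓ + c) ^ c)) ^ (d + 2) := by
  set Q : ℕ := 2 ^ ((ℓ + c) ^ c) with hQ
  have hQ1 : 1 ≤ Q := Nat.one_le_two_pow
  have hQd : 1 ≤ Q ^ d := Nat.one_le_pow _ _ hQ1
  set B : ℕ := (d + 1) * Q ^ d with hB
  have hB1 : 1 ≤ B := by
    rw [hB]
    calc (1 : ℕ) = 1 * 1 := rfl
      _ ≤ (d + 1) * Q ^ d := Nat.mul_le_mul (by omega) hQd
  have hs : N ^ d + d ≤ B := by
    calc N ^ d + d ≤ Q ^ d + d * Q ^ d :=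
          add_le_add (Nat.pow_le_pow_left hN d) (Nat.le_mul_of_pos_right d hQd)
      _ = B := by rw [hB]; ring
  have hQpos : 0 < Q := hQ1
  have hBpos : 0 < B := hB1
  have i1 : Q * B ≤ Q * Q * B := by
    rw [mul_assoc]; exact Nat.le_mul_of_pos_left _ hQpos
  have i2 : Q * Q ≤ Q * Q * B := Nat.le_mul_of_pos_right _ hBpos
  have i3 : Q ≤ Q * Q * B := (Nat.le_mul_of_pos_left Q hQpos).trans i2
  have i5 : 1 ≤ Q * Q * B := hQ1.trans i3
  generalize N ^ d + d = s at hs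
  calc (J * (s + (J * s + J) + 1) + J + (I * s + I) + 1) + (I * (s + (I * s + I) + 1) + I + (J * s + J) + 1)
      ≤ (Q * (B + (Q * B + Q) + 1) + Q + (Q * B + Q) + 1) +
          (Q * (B + (Q * B + Q) + 1) + Q + (Q * B + Q) + 1) := by gcongr
    _ = 2 * (Q * Q * B) + 4 * (Q * B) + 2 * (Q * Q) + 6 * Q + 2 := by ring
    _ ≤ 2 * (Q * Q * B) + 4 * (Q * Q * B) + 2 * (Q * Q * B) + 6 * (Q * Q * B) + 2 * (Q * Q * B) := by
        linarith [i1, i2, i3, i5]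
    _ = 16 * (Q * Q * B) := by ring
    _ = 16 * (d + 1) * Q ^ (d + 2) := by rw [hB]; ring

/-- Arithmetic: `16 (d+1) (2^((ℓ + c)^c))^(d+2) ≤ 2^((ℓ + C)^C)` for `C := c + 2d + 6`, uniformly in `ℓ`
(one quasi-polynomial exponent absorbs polynomial post-processing). [folklore] -/
theorem absorb₂ (c d : ℕ) : ∃ C : ℕ, ∀ ℓ : ℕ,
    16 * (d + 1) * (2 ^ ((ℓ + c) ^ c)) ^ (d + 2) ≤ 2 ^ ((ℓ + C) ^ C) := by
  refine ⟨c + 2 * d + 6, fun ℓ => ?_⟩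
  have hE : 1 ≤ (ℓ + c) ^ c := by
    rcases Nat.eq_zero_or_pos c with rfl | hc
    · simp
    · exact Nat.one_le_pow _ _ (by omega)
  have hd : d + 1 ≤ 2 ^ d := Nat.lt_two_pow_self
  have h16 : 16 * (d + 1) ≤ 2 ^ (d + 4) := by
    calc 16 * (d + 1) ≤ 16 * 2 ^ d := Nat.mul_le_mul_left _ hd
      _ = 2 ^ (d + 4) := by rw [pow_add]; ring
  have hexp : d + 4 + (ℓ + c) ^ c * (d + 2) ≤ (ℓ + (c + 2 * d + 6)) ^ (c + 2 * d + 6) := by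
    calc d + 4 + (ℓ + c) ^ c * (d + 2) ≤ (ℓ + c) ^ c * (2 * d + 6) := by nlinarith [hE]
      _ ≤ (ℓ + c + (2 * d + 6)) ^ c * (ℓ + c + (2 * d + 6)) :=
          Nat.mul_le_mul (Nat.pow_le_pow_left (by omega) c) (by omega)
      _ = (ℓ + (c + 2 * d + 6)) ^ (c + 1) := by
          rw [pow_succ, show ℓ + c + (2 * d + 6) = ℓ + (c + 2 * d + 6) by omega]
      _ ≤ (ℓ + (c + 2 * d + 6)) ^ (c + 2 * d + 6) := Nat.pow_le_pow_right (by omega) (by omega)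
  calc 16 * (d + 1) * (2 ^ ((ℓ + c) ^ c)) ^ (d + 2)
      ≤ 2 ^ (d + 4) * (2 ^ ((ℓ + c) ^ c)) ^ (d + 2) := Nat.mul_le_mul_right _ h16
    _ = 2 ^ (d + 4 + (ℓ + c) ^ c * (d + 2)) := by rw [← pow_mul, ← pow_add]
    _ ≤ 2 ^ ((ℓ + (c + 2 * d + 6)) ^ (c + 2 * d + 6)) := Nat.pow_le_pow_right (by norm_num) hexp

/-- Arithmetic: `(2^((ℓ + c₁)^c₁))^c₀ + c₀ ≤ 2^((ℓ + C)^C)` for `C := c₁ + 2c₀ + 1`, uniformly in `ℓ`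
(a polynomial of a quasi-polynomial is quasi-polynomial). [folklore] -/
theorem absorb₁ (c₀ c₁ : ℕ) : ∃ C : ℕ, ∀ ℓ : ℕ,
    (2 ^ ((ℓ + c₁) ^ c₁)) ^ c₀ + c₀ ≤ 2 ^ ((ℓ + C) ^ C) := by
  refine ⟨c₁ + 2 * c₀ + 1, fun ℓ => ?_⟩
  have hE : 1 ≤ (ℓ + c₁) ^ c₁ := by
    rcases Nat.eq_zero_or_pos c₁ with rfl | hc
    · simp
    · exact Nat.one_le_pow _ _ (by omega)
  have hpow : ∀ a b : ℕ, 2 ^ a + b ≤ 2 ^ (a + b) := by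
    intro a b
    have hb : b + 1 ≤ 2 ^ b := Nat.lt_two_pow_self
    have ha : 1 ≤ 2 ^ a := Nat.one_le_two_pow
    calc 2 ^ a + b ≤ 2 ^ a + 2 ^ a * b := by nlinarith
      _ = 2 ^ a * (b + 1) := by ring
      _ ≤ 2 ^ a * 2 ^ b := Nat.mul_le_mul_left _ hb
      _ = 2 ^ (a + b) := by rw [pow_add]
  have hexp : (ℓ + c₁) ^ c₁ * c₀ + c₀ ≤ (ℓ + (c₁ + 2 * c₀ + 1)) ^ (c₁ + 2 * c₀ + 1) := by
    calc (ℓ + c₁) ^ c₁ * c₀ + c₀ ≤ (ℓ + c₁) ^ c₁ * (2 * c₀ + 1) := by nlinarith [hE]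
      _ ≤ (ℓ + c₁ + (2 * c₀ + 1)) ^ c₁ * (ℓ + c₁ + (2 * c₀ + 1)) :=
          Nat.mul_le_mul (Nat.pow_le_pow_left (by omega) c₁) (by omega)
      _ = (ℓ + (c₁ + 2 * c₀ + 1)) ^ (c₁ + 1) := by
          rw [pow_succ, show ℓ + c₁ + (2 * c₀ + 1) = ℓ + (c₁ + 2 * c₀ + 1) by omega]
      _ ≤ (ℓ + (c₁ + 2 * c₀ + 1)) ^ (c₁ + 2 * c₀ + 1) := Nat.pow_le_pow_right (by omega) (by omega)
  calc (2 ^ ((ℓ + c₁) ^ c₁)) ^ c₀ + c₀ = 2 ^ ((ℓ + c₁) ^ c₁ * c₀) + c₀ := by rw [← pow_mul]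
    _ ≤ 2 ^ ((ℓ + c₁) ^ c₁ * c₀ + c₀) := hpow _ _
    _ ≤ 2 ^ ((ℓ + (c₁ + 2 * c₀ + 1)) ^ (c₁ + 2 * c₀ + 1)) := Nat.pow_le_pow_right (by norm_num) hexp

end SignEliminationReduction

open SignEliminationReduction in
/-- **`SignElimination → ZeroOneTransfer`** (registered reduction of line `planar-dimer-sign-elimination`,
crux stmt-ValiantsHypothesis-5066).  The hypothesis `hS` is verbatim the registered bet
`stub_signElimination`: for a `0/1`-coefficient family `f` over `ℝ≥0` whose complexification is a
`2^((log₂ n + c)^c)`-projection over `ℂ` of the `N × N` square-grid dimer polynomial, there are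
quasi-polynomial `N, I, J` and monotone grid-dimer projections `m_i`, `g_j` with `Σ m_i ≠ 0` and
`f n · Σ m_i = Σ g_j`.  Conclusion: the crux.  Proof: `VP ⊆ VQF` + (U) at `R = ℂ` produce the hypothesis
of `hS`; (G) item 5072 and (F1) projection closure give cofactors for every summand; bookkeeping.
[cite: DattaKulkarniLimayeMahajan2010, §4.4] [cite: Propp2003, §2] -/
theorem signEliminationReduction
    (hS :
      ∀ (σ : ℕ → Type) [∀ n, Fintype (σ n)] (f : ∀ n, MvPolynomial (σ n) NNReal),
        (∀ n m, MvPolynomial.coeff m (f n) = 0 ∨ MvPolynomial.coeff m (f n) = 1) →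
        (∃ c : ℕ, ∀ n : ℕ, ∃ N : ℕ, N ≤ 2 ^ ((Nat.log 2 n + c) ^ c) ∧
          IsProjection (MvPolynomial.map (Complex.ofRealHom.comp NNReal.toRealHom) (f n))
            (∑ f ∈ (Finset.univ : Finset (Fin N × Fin N → Fin N × Fin N)).filter (fun f => ∀ v, f (f v) = v ∧ f v ≠ v ∧ (((v.1 : ℕ) + 1 = (f v).1 ∧ (v.2 : ℕ) = (f v).2) ∨ (((f v).1 : ℕ) + 1 = v.1 ∧ (v.2 : ℕ) = (f v).2) ∨ ((v.1 : ℕ) = (f v).1 ∧ (v.2 : ℕ) + 1 = (f v).2) ∨ ((v.1 : ℕ) = (f v).1 ∧ ((f v).2 : ℕ) + 1 = v.2))), ∏ v : Fin N × Fin N, (MvPolynomial.X (v, f v) : MvPolynomial ((Fin N × Fin N) × (Fin N × Fin N)) ℂ))) →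
        ∃ c : ℕ, ∀ n : ℕ, ∃ N I J : ℕ, N ≤ 2 ^ ((Nat.log 2 n + c) ^ c) ∧ I ≤ 2 ^ ((Nat.log 2 n + c) ^ c) ∧
          J ≤ 2 ^ ((Nat.log 2 n + c) ^ c) ∧
          ∃ (m : Fin I → MvPolynomial (σ n) NNReal) (g : Fin J → MvPolynomial (σ n) NNReal),
            (∀ i, IsProjection (m i)
              (∑ f ∈ (Finset.univ : Finset (Fin N × Fin N → Fin N × Fin N)).filter (fun f => ∀ v, f (f v) = v ∧ f v ≠ v ∧ (((v.1 : ℕ) + 1 = (f v).1 ∧ (v.2 : ℕ) = (f v).2) ∨ (((f v).1 : ℕ) + 1 = v.1 ∧ (v.2 : ℕ) = (f v).2) ∨ ((v.1 : ℕ) = (f v).1 ∧ (v.2 : ℕ) + 1 = (f v).2) ∨ ((v.1 : ℕ) = (f v).1 ∧ ((f v).2 : ℕ) + 1 = v.2))), ∏ v : Fin N × Fin N, (MvPolynomial.X (v, f v) : MvPolynomial ((Fin N × Fin N) × (Fin N × Fin N)) NNReal))) ∧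
            (∀ j, IsProjection (g j)
              (∑ f ∈ (Finset.univ : Finset (Fin N × Fin N → Fin N × Fin N)).filter (fun f => ∀ v, f (f v) = v ∧ f v ≠ v ∧ (((v.1 : ℕ) + 1 = (f v).1 ∧ (v.2 : ℕ) = (f v).2) ∨ (((f v).1 : ℕ) + 1 = v.1 ∧ (v.2 : ℕ) = (f v).2) ∨ ((v.1 : ℕ) = (f v).1 ∧ (v.2 : ℕ) + 1 = (f v).2) ∨ ((v.1 : ℕ) = (f v).1 ∧ ((f v).2 : ℕ) + 1 = v.2))), ∏ v : Fin N × Fin N, (MvPolynomial.X (v, f v) : MvPolynomial ((Fin N × Fin N) × (Fin N × Fin N)) NNReal))) ∧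
            (∑ i, m i) ≠ 0 ∧ f n * ∑ i, m i = ∑ j, g j) :
    ZeroOneTransfer := by
  classical
  intro σ _ f h01 hVP
  -- (U): VP ⊆ VQF (tree) + formulas are projections of grid dimers (Stub 1 at R = ℂ)
  obtain ⟨c₀, hc₀⟩ := stub_formulaGridProjection
  obtain ⟨c₁, hc₁⟩ := (BCS1997_thm_21_33_holds ℂ σ
    (fun n => MvPolynomial.map (Complex.ofRealHom.comp NNReal.toRealHom) (f n)) hVP.1).2
    (IsVPFamily.isVQPFamily hVP).2
  obtain ⟨C₁, hC₁⟩ := absorb₁ c₀ c₁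
  have hU : ∃ c : ℕ, ∀ n : ℕ, ∃ N : ℕ, N ≤ 2 ^ ((Nat.log 2 n + c) ^ c) ∧
      IsProjection (MvPolynomial.map (Complex.ofRealHom.comp NNReal.toRealHom) (f n))
        (∑ f ∈ (Finset.univ : Finset (Fin N × Fin N → Fin N × Fin N)).filter (fun f => ∀ v, f (f v) = v ∧ f v ≠ v ∧ (((v.1 : ℕ) + 1 = (f v).1 ∧ (v.2 : ℕ) = (f v).2) ∨ (((f v).1 : ℕ) + 1 = v.1 ∧ (v.2 : ℕ) = (f v).2) ∨ ((v.1 : ℕ) = (f v).1 ∧ (v.2 : ℕ) + 1 = (f v).2) ∨ ((v.1 : ℕ) = (f v).1 ∧ ((f v).2 : ℕ) + 1 = v.2))), ∏ v : Fin N × Fin N, (MvPolynomial.X (v, f v) : MvPolynomial ((Fin N × Fin N) × (Fin N × Fin N)) ℂ)) := by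
    refine ⟨C₁, fun n => ?_⟩
    obtain ⟨N, hN, hproj⟩ := hc₀ ℂ (σ n) (MvPolynomial.map (Complex.ofRealHom.comp NNReal.toRealHom) (f n))
    refine ⟨N, ?_, hproj⟩
    have hE := hc₁ n
    calc N ≤ (formulaComplexity (MvPolynomial.map (Complex.ofRealHom.comp NNReal.toRealHom) (f n))) ^ c₀ + c₀ := hN
      _ ≤ (2 ^ ((Nat.log 2 n + c₁) ^ c₁)) ^ c₀ + c₀ := by gcongr
      _ ≤ 2 ^ ((Nat.log 2 n + C₁) ^ C₁) := hC₁ (Nat.log 2 n)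
  -- (S): the ratio of two short sums of monotone grid-dimer projections
  obtain ⟨c₂, hc₂⟩ := hS σ f h01 hU
  -- (G): one cofactor for the grid dimer polynomial
  obtain ⟨d, hd⟩ := Summit.ValiantsHypothesis.ValiantsHypothesis.Theorems.squareGridDimersDivisionEasy_proof
  obtain ⟨C, hC⟩ := absorb₂ c₂ d
  refine ⟨C, fun n => ?_⟩
  obtain ⟨N, I, J, hN, hI, hJ, m, g, hm, hg, hMne, hfm⟩ := hc₂ n
  obtain ⟨h, hne, hle⟩ := hd N
  -- (F1): transport the cofactor to every numerator and denominator summand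
  choose hm' hm'ne hm'le using fun i => stub_projClosure _ _ _ _ (hm i) h hne
  choose hg' hg'ne hg'le using fun j => stub_projClosure _ _ _ _ (hg j) h hne
  refine ⟨(∑ i, m i) * (∏ i, hm' i) * ∏ j, hg' j, ?_, ?_⟩
  · exact mul_ne_zero (mul_ne_zero hMne (Finset.prod_ne_zero_iff.mpr fun i _ => hm'ne i))
      (Finset.prod_ne_zero_iff.mpr fun j _ => hg'ne j)
  · calc complexity (f n * ((∑ i, m i) * (∏ i, hm' i) * ∏ j, hg' j)) +
          complexity ((∑ i, m i) * (∏ i, hm' i) * ∏ j, hg' j)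
        ≤ (J * ((N ^ d + d) + (J * (N ^ d + d) + J) + 1) + J + (I * (N ^ d + d) + I) + 1) +
            (I * ((N ^ d + d) + (I * (N ^ d + d) + I) + 1) + I + (J * (N ^ d + d) + J) + 1) :=
          quotient_bound (f n) m hm' g hg' (N ^ d + d) hfm (fun i => (hm'le i).trans hle)
            fun j => (hg'le j).trans hle
      _ ≤ 16 * (d + 1) * (2 ^ ((Nat.log 2 n + c₂) ^ c₂)) ^ (d + 2) := arith hN hI hJ
      _ ≤ 2 ^ ((Nat.log 2 n + C) ^ C) := hC (Nat.log 2 n)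

end Summit.ValiantsHypothesis.ValiantsHypothesis.Theorems.DivisionGapZeroOneTransfer
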